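import Mathlib.Analysis.Normed.Module.Basic
import Mathlib.Topology.UniformSpace.HeineCantor
import Mathlib.Topology.Order.Compact
import HarnessLib

/-!
# Uniform smallness of a continuous function near a level where it vanishes

Topic `Geometry/Riemannian` (elementary topology). In the interior surgery of Weinstein's disk
(Weinstein 1968, proof of the main theorem, step (3)) all the constants of the unwinding of the
collar cone map `C` — the size of the angular drift `N(C(σu)) - u`, of the radial defect
`‖C(σu)‖ - σ`, and of their `u`-derivatives — are controlled by one principle: they are continuous
in `(σ, u)` on `[1-ε, 1+ε] × S` (`S` compact) and vanish at `σ = 1` (where `C` is the identity),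
hence are uniformly small for `|σ - 1| ≤ ε₁` (`exists_forall_norm_lt_near_one`); likewise a
quantity which is `≥ 2μ₀` at `σ = 1` stays `≥ μ₀` (`exists_forall_le_near_one`).

## References

* A. Weinstein, Ann. of Math. (2) 87 (1968), 29–41. [cite: Weinstein1968]

Tags: [UniformContinuity] [Weinstein1968]
-/

noncomputable section

open Set Function Metric

namespace Literature.Geometry.Riemannian

variable {V : Type*} [PseudoMetricSpace V] {W : Type*} [NormedAddCommGroup W]

/-- **Uniform smallness near the level `σ = 1`.** If `f` is continuous on `[1-ε, 1+ε] × S` with `S`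
compact and `f(1, u) = 0` for `u ∈ S`, then for every `κ > 0` there is `ε₁ ∈ (0, ε]` with
`‖f(σ, u)‖ < κ` whenever `|σ - 1| ≤ ε₁`, `u ∈ S`. [folklore] -/
theorem exists_forall_norm_lt_near_one {S : Set V} (hS : IsCompact S) {ε : ℝ} (hε : 0 < ε)
    {f : ℝ × V → W} (hf : ContinuousOn f (Icc (1 - ε) (1 + ε) ×ˢ S)) (h0 : ∀ u ∈ S, f (1, u) = 0)
    {κ : ℝ} (hκ : 0 < κ) :
    ∃ ε₁ : ℝ, 0 < ε₁ ∧ ε₁ ≤ ε ∧ ∀ σ : ℝ, |σ - 1| ≤ ε₁ → ∀ u ∈ S, ‖f (σ, u)‖ < κ := by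
  have hK : IsCompact (Icc (1 - ε) (1 + ε) ×ˢ S) := isCompact_Icc.prod hS
  have huc := hK.uniformContinuousOn_of_continuous hf
  obtain ⟨δ, hδ, hδf⟩ := Metric.uniformContinuousOn_iff.1 huc κ hκ
  refine ⟨min ε (δ / 2), lt_min hε (by linarith), min_le_left _ _, ?_⟩
  intro σ hσ u hu
  have hσε : |σ - 1| ≤ ε := hσ.trans (min_le_left _ _)
  have hσδ : |σ - 1| < δ := lt_of_le_of_lt (hσ.trans (min_le_right _ _)) (by linarith)
  have hmem : (σ, u) ∈ Icc (1 - ε) (1 + ε) ×ˢ S :=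
    ⟨⟨by linarith [(abs_le.1 hσε).1], by linarith [(abs_le.1 hσε).2]⟩, hu⟩
  have hmem1 : ((1 : ℝ), u) ∈ Icc (1 - ε) (1 + ε) ×ˢ S := ⟨⟨by linarith, by linarith⟩, hu⟩
  have hd : dist (σ, u) ((1 : ℝ), u) < δ := by
    rw [Prod.dist_eq, dist_self, Real.dist_eq]
    exact max_lt hσδ (lt_of_le_of_lt le_rfl hδ)
  have h := hδf _ hmem _ hmem1 hd
  rwa [h0 u hu, dist_zero_right] at h

/-- **A positive lower bound persists near the level `σ = 1`.** If `g` is continuous on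
`[1-ε, 1+ε] × S` with `S` compact and `2μ₀ ≤ g(1, u)` on `S` (`μ₀ > 0`), then `μ₀ ≤ g(σ, u)` for
`|σ - 1| ≤ ε₁`, `u ∈ S`, for some `ε₁ ∈ (0, ε]`. [folklore] -/
theorem exists_forall_le_near_one {S : Set V} (hS : IsCompact S) {ε : ℝ} (hε : 0 < ε)
    {g : ℝ × V → ℝ} (hg : ContinuousOn g (Icc (1 - ε) (1 + ε) ×ˢ S)) {μ₀ : ℝ} (hμ₀ : 0 < μ₀)
    (h1 : ∀ u ∈ S, 2 * μ₀ ≤ g (1, u)) :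
    ∃ ε₁ : ℝ, 0 < ε₁ ∧ ε₁ ≤ ε ∧ ∀ σ : ℝ, |σ - 1| ≤ ε₁ → ∀ u ∈ S, μ₀ ≤ g (σ, u) := by
  -- apply the previous lemma to `f(σ, u) = g(σ, u) - g(1, u)`
  set f : ℝ × V → ℝ := fun q ↦ g q - g (1, q.2) with hf
  have hfc : ContinuousOn f (Icc (1 - ε) (1 + ε) ×ˢ S) := by
    refine hg.sub ?_
    have h2 : ContinuousOn (fun q : ℝ × V ↦ ((1 : ℝ), q.2)) (Icc (1 - ε) (1 + ε) ×ˢ S) :=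
      (continuous_const.prodMk continuous_snd).continuousOn
    refine hg.comp h2 ?_
    intro q hq
    exact ⟨⟨by linarith, by linarith⟩, hq.2⟩
  have h0 : ∀ u ∈ S, f (1, u) = 0 := fun u _ ↦ by simp [hf]
  obtain ⟨ε₁, hε₁, hε₁ε, hsmall⟩ := exists_forall_norm_lt_near_one hS hε hfc h0 hμ₀
  refine ⟨ε₁, hε₁, hε₁ε, fun σ hσ u hu ↦ ?_⟩
  have h := hsmall σ hσ u hu
  rw [Real.norm_eq_abs, abs_lt] at h
  have := h1 u hu
  simp only [hf] at h
  linarith [h.1]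

end Literature.Geometry.Riemannian

end
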